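import Summits.AtomisticToContinuum.HydrodynamicLimit.Theorems.InformationPercolationEngineChaosClosesEulerStressIsotropyF
import HarnessLib

/-!
# Window-to-cone step of `ParityBandClosure` — helper M: tools of the assembly in probability

Support file for the stub `stub_stressIsotropyOfWindowCovariance` of the line `transfer-weighted-parity-chain`
(skeleton v4) of the crux `JParityClosure.ParityBandClosure` (stmt-AtomisticToContinuum-17608).

WHAT.  Elementary tools of the final assembly:

* §1 the signed parts `g₊ = max(g, 0)`, `g₋ = max(−g, 0)` of a continuous density cut-off vanishing above `η₀`
  (continuous, nonnegative, vanishing above `η₀`, `|g| = g₊ + g₋`), and the UNIFORM modulus of such a cut-off on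
  `[0, ∞)` (`exists_modulus_of_vanishing`: uniform continuity on the compact `[0, η₀ ∨ 0 + 1]`, zero beyond);
* §2 the windowed quadratic tail event from the single-time cubic tails of `TwoClocks.EnergyCurrentTails`
  (Tonelli + Markov along the flow, `measure_lt_intervalIntegral_flow_le`, and `sqTail V ≤ cubeTail V ≤ cubeTail M` for
  `1 ≤ V`, `M ≤ V`);
* §3 the tolerance budget of the window-to-cone step (`window_budget`): with the tolerances chosen as stated, the
  pathwise bound of helper L is at most `η`;
* §4 a seven-piece union bound.

REFERENCES.  Elementary; the sister's `InformationPercolationEngineChaosClosesEulerStressIsotropyD/F.lean`.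
-/

noncomputable section

namespace Summit.AtomisticToContinuum.HydrodynamicLimit.Theorems.ParityBandClosureWindowToCone

open scoped BigOperators Topology Classical MeasureTheory ENNReal InnerProductSpace
open Filter Set MeasureTheory Function
open Literature.MathematicalPhysics.KineticTheory
open Literature.Analysis.FluidPDE
open Literature.Analysis.FunctionSpaces
open Summit.AtomisticToContinuum.HydrodynamicLimit.Theorems.LocalSecondLawNegative
open Summit.AtomisticToContinuum.HydrodynamicLimit.Theorems.LocalSecondLawLedger
open Summit.AtomisticToContinuum.HydrodynamicLimit.Theorems.ChaosClosesEulerReduction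
open Summit.AtomisticToContinuum.HydrodynamicLimit.Theorems.ChaosClosesEulerStressIsotropy

variable {N : ℕ}

/-! ## §1 Signed parts and the uniform modulus of a density cut-off -/

/-- The positive part of a cut-off vanishing above `η₀` is continuous, nonnegative and vanishes above `η₀`. [folklore] -/
theorem posPart_props {g : ℝ → ℝ} (hgc : Continuous g) {η₀ : ℝ} (hg0 : ∀ b, η₀ ≤ b → g b = 0) :
    Continuous (fun b => max (g b) 0) ∧ (∀ b, η₀ ≤ b → max (g b) 0 = 0) ∧ (∀ b, 0 ≤ max (g b) 0) :=
  ⟨hgc.max continuous_const, fun b hb => by rw [hg0 b hb, max_self], fun b => le_max_right _ _⟩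

/-- The negative part of a cut-off vanishing above `η₀` is continuous, nonnegative and vanishes above `η₀`. [folklore] -/
theorem negPart_props {g : ℝ → ℝ} (hgc : Continuous g) {η₀ : ℝ} (hg0 : ∀ b, η₀ ≤ b → g b = 0) :
    Continuous (fun b => max (-g b) 0) ∧ (∀ b, η₀ ≤ b → max (-g b) 0 = 0) ∧ (∀ b, 0 ≤ max (-g b) 0) :=
  ⟨hgc.neg.max continuous_const, fun b hb => by rw [hg0 b hb, neg_zero, max_self], fun b => le_max_right _ _⟩

/-- **Uniform modulus of a continuous cut-off vanishing above `η₀`, on `[0, ∞)`**: for `κ > 0` there is `λ > 0` with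
`|g b − g b'| ≤ κ` whenever `b, b' ≥ 0`, `|b − b'| < λ`. [folklore] -/
theorem exists_modulus_of_vanishing {g : ℝ → ℝ} (hgc : Continuous g) {η₀ : ℝ} (hg0 : ∀ b, η₀ ≤ b → g b = 0) {κ : ℝ}
    (hκ : 0 < κ) : ∃ lam : ℝ, 0 < lam ∧ ∀ b b', 0 ≤ b → 0 ≤ b' → |b - b'| < lam → |g b - g b'| ≤ κ := by
  set R : ℝ := max η₀ 0 + 1 with hR
  have hK : IsCompact (Icc (0 : ℝ) R) := isCompact_Icc
  obtain ⟨d, hd, hU⟩ := Metric.uniformContinuousOn_iff.1 (hK.uniformContinuousOn_of_continuous hgc.continuousOn) κ hκ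
  refine ⟨min d 1, lt_min hd one_pos, fun b b' hb hb' hbb => ?_⟩
  have hbd : |b - b'| < d := hbb.trans_le (min_le_left _ _)
  have hb1 : |b - b'| < 1 := hbb.trans_le (min_le_right _ _)
  by_cases hbR : b ≤ R
  · by_cases hb'R : b' ≤ R
    · have h := hU b ⟨hb, hbR⟩ b' ⟨hb', hb'R⟩ (by rwa [Real.dist_eq])
      rw [Real.dist_eq] at h
      exact h.le
    · -- `b' > R`, so both are above `η₀`
      rw [not_le] at hb'R
      have h1 : η₀ ≤ b' := by have := le_max_left η₀ 0; linarith
      have h2 : η₀ ≤ b := by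
        have := le_max_left η₀ 0; rw [abs_lt] at hb1; linarith
      rw [hg0 b h2, hg0 b' h1, sub_self, abs_zero]; exact hκ.le
  · rw [not_le] at hbR
    have h1 : η₀ ≤ b := by have := le_max_left η₀ 0; linarith
    have h2 : η₀ ≤ b' := by
      have := le_max_left η₀ 0; rw [abs_lt] at hb1; linarith
    rw [hg0 b h1, hg0 b' h2, sub_self, abs_zero]; exact hκ.le

/-! ## §2 The windowed quadratic tail event -/

/-- The mean quadratic tail at level `V ≥ max M 1` is below the mean cubic tail at level `M`. [folklore] -/
theorem mean_sqTail_le_mean_cubeTail_of_le {M V : ℝ} (hV1 : 1 ≤ V) (hMV : M ≤ V) (w : Phase N) :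
    ((N + 1 : ℕ) : ℝ)⁻¹ * ∑ i, sqTail V (w i).2 ≤ ((N : ℝ) + 1)⁻¹ * ∑ i, cubeTail M (w i).2 := by
  have hcast : ((N : ℝ) + 1) = ((N + 1 : ℕ) : ℝ) := by push_cast; ring
  rw [hcast]
  refine (mean_sqTail_le_mean_cubeTail hV1 w).trans (mul_le_mul_of_nonneg_left (Finset.sum_le_sum fun i _ =>
    cubeTail_antitone hMV _) (by positivity))

/-- **The windowed quadratic tail event.**  For a law carried by the good set of a hard-sphere flow on `𝕋³`, if the
single-time mean cubic tails at level `M` have expectation `≤ e` on `(0, τ]`, then for `V ≥ max M 1` and `κ > 0`: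
`P {κ < ∫_{[0,τ]} (N+1)⁻¹ Σ sqTail V (vᵢ(s)) ds} ≤ ofReal (τ e / κ)`. [folklore] -/
theorem measure_tailEvent_le {ε : ℝ} (Φ : HardSphereFlow (Torus.geometry (Fin 3)) ε (N + 1))
    {P : Measure (Phase N)} [IsFiniteMeasure P] (hP : P Φ.goodᶜ = 0) {M V : ℝ} (hV1 : 1 ≤ V) (hMV : M ≤ V)
    {τ : ℝ} (hτ : 0 ≤ τ) {e : ℝ} (he : 0 ≤ e)
    (hC : ∀ s ∈ Set.Ioc 0 τ, ∫⁻ z, ENNReal.ofReal (((N : ℝ) + 1)⁻¹ * ∑ i, cubeTail M ((Φ.flow s z) i).2) ∂P ≤ ENNReal.ofReal e)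
    {κ : ℝ} (hκ : 0 < κ) :
    P {z | κ < ∫ s in Icc 0 τ, ((N + 1 : ℕ) : ℝ)⁻¹ * ∑ i, sqTail V ((Φ.flow s z) i).2} ≤ ENNReal.ofReal (τ * e / κ) := by
  set f : Phase N → ℝ := fun w => ((N : ℝ) + 1)⁻¹ * ∑ i, cubeTail M (w i).2 with hf
  have hf0 : ∀ w, 0 ≤ f w := fun w => mul_nonneg (by positivity) (Finset.sum_nonneg fun i _ => cubeTail_nonneg M _)
  have h1 := ChaosClosesEulerReadout.measure_lt_intervalIntegral_flow_le Φ (μ := P) hP (f := f) (measurable_mean_cubeTail M)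
    hf0 (fun z hz a b hab => intervalIntegrable_mean_cubeTail Φ M hz hab) hτ he (fun s hs => hC s hs) hκ
  rw [sub_zero] at h1
  refine le_trans ?_ h1
  -- on the good set the quadratic-tail event is inside the cubic-tail event
  have hsub : {z | κ < ∫ s in Icc 0 τ, ((N + 1 : ℕ) : ℝ)⁻¹ * ∑ i, sqTail V ((Φ.flow s z) i).2} ∩ Φ.good ⊆
      {z | κ < ∫ s in (0 : ℝ)..τ, f (Φ.flow s z)} := by
    rintro z ⟨hz, hzg⟩
    simp only [Set.mem_setOf_eq] at hz ⊢
    rw [intervalIntegral.integral_of_le hτ, ← integral_Icc_eq_integral_Ioc]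
    refine hz.trans_le (setIntegral_mono_on ?_ (integrableOn_mean_cubeTail Φ M hzg 0 τ) measurableSet_Icc
      fun s _ => mean_sqTail_le_mean_cubeTail_of_le hV1 hMV _)
    have hγ : Measurable fun s => Φ.flow s z := (Φ.isTrajectory z hzg).measurable_torus
    refine Measure.integrableOn_of_bounded (M := 2 * ke z) (by rw [Real.volume_Icc]; exact ENNReal.ofReal_ne_top)
      ((Measurable.comp (measurable_mean_sqTail V) hγ :)).aestronglyMeasurable (ae_of_all _ fun s => ?_)
    rw [Real.norm_eq_abs, abs_of_nonneg (mul_nonneg (by positivity) (Finset.sum_nonneg fun i _ => sqTail_nonneg V _)),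
      ← ke_flow_eq' Φ hzg s]
    exact mean_sqTail_le_two_ke V _
  calc P {z | κ < ∫ s in Icc 0 τ, ((N + 1 : ℕ) : ℝ)⁻¹ * ∑ i, sqTail V ((Φ.flow s z) i).2}
      ≤ P ({z | κ < ∫ s in Icc 0 τ, ((N + 1 : ℕ) : ℝ)⁻¹ * ∑ i, sqTail V ((Φ.flow s z) i).2} ∩ Φ.good) + P Φ.goodᶜ := by
        refine (measure_mono fun z hz => ?_).trans (measure_union_le _ _)
        by_cases hzg : z ∈ Φ.good
        · exact Or.inl ⟨hz, hzg⟩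
        · exact Or.inr hzg
    _ ≤ P {z | κ < ∫ s in (0 : ℝ)..τ, f (Φ.flow s z)} := by rw [hP, add_zero]; exact measure_mono hsub

/-! ## §3 The tolerance budget -/

/-- `x · (c/(d · (x+1))) ≤ c/d`-type bookkeeping: `x · (η/(k (x + 1))) ≤ η/k` for `x ≥ 0`, `η ≥ 0`, `k > 0`. [folklore] -/
theorem mul_div_mul_add_one_le {x η k : ℝ} (hx : 0 ≤ x) (hη : 0 ≤ η) (hk : 0 < k) : x * (η / (k * (x + 1))) ≤ η / k := by
  rw [← div_div]
  exact mul_div_add_one_le hx (div_nonneg hη hk.le)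

/-- **The tolerance budget of the window-to-cone step.** [folklore] -/
theorem window_budget {η A Gb KE τ σ Rcap lam V Kb r ηW κa κg κT : ℝ} (hη : 0 < η) (hA : 0 ≤ A) (hGb : 0 ≤ Gb)
    (hKE : 0 ≤ KE) (hτ : 0 ≤ τ) (hσ : 0 ≤ σ) (hR : 0 ≤ Rcap) (hlam : 0 < lam) (hV : 0 ≤ V) (hKb : 0 ≤ Kb) (hr0 : 0 ≤ r)
    (hr1 : r ≤ 1) (hηW : ηW = η / (16 * (A + 1))) (hκa : κa = η / (8 * (30 * Gb * KE * τ + 1)))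
    (hκg : κg = η / (8 * (30 * A * KE * τ + 1)))
    (hκT : κT = η / (8 * ((Gb * (3 * A) * 10 + Gb * A * σ ^ 3 * Rcap / lam * 30) + 1)))
    (hrL : r ≤ η / (4 * ((4 * (30 * Gb * A * KE) + Gb * (3 * A) * (4 * V * (16 * KE * τ + 16 * Kb) +
      4 * V ^ 2 * (8 * (1 / 2 + KE) * τ)) + Gb * A * σ ^ 3 * Rcap / lam * (60 * V ^ 2 * (8 * (1 / 2 + KE) * τ))) + 1))) :
    4 * r ^ 2 * (30 * Gb * A * KE) + (A * (ηW + ηW) + Gb * (3 * A * (4 * V * (16 * KE * r * τ + 16 * r * Kb) +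
      4 * V ^ 2 * (8 * r * (1 / 2 + KE) * τ) + 6 * κT + 4 * κT)) + 30 * (Gb * κa + A * κg) * (KE * τ) +
      Gb * A * σ ^ 3 * Rcap / lam * (60 * V ^ 2 * (8 * r * (1 / 2 + KE) * τ) + 30 * κT)) ≤ η := by
  set cT : ℝ := Gb * (3 * A) * 10 + Gb * A * σ ^ 3 * Rcap / lam * 30 with hcT
  set Lr : ℝ := 4 * (30 * Gb * A * KE) + Gb * (3 * A) * (4 * V * (16 * KE * τ + 16 * Kb) +
      4 * V ^ 2 * (8 * (1 / 2 + KE) * τ)) + Gb * A * σ ^ 3 * Rcap / lam * (60 * V ^ 2 * (8 * (1 / 2 + KE) * τ)) with hLr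
  have hcT0 : 0 ≤ cT := by positivity
  have hLr0 : 0 ≤ Lr := by positivity
  -- the five pieces
  have p1 : A * (ηW + ηW) ≤ η / 8 := by
    rw [hηW]
    have := mul_div_mul_add_one_le hA hη.le (by norm_num : (0 : ℝ) < 8)
    have e : A * (η / (16 * (A + 1)) + η / (16 * (A + 1))) = A * (η / (8 * (A + 1))) := by field_simp; ring
    rw [e]; exact this
  have p2 : 30 * (Gb * κa) * (KE * τ) ≤ η / 8 := by
    rw [hκa]
    have := mul_div_mul_add_one_le (x := 30 * Gb * KE * τ) (by positivity) hη.le (by norm_num : (0 : ℝ) < 8)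
    calc 30 * (Gb * (η / (8 * (30 * Gb * KE * τ + 1)))) * (KE * τ) = 30 * Gb * KE * τ * (η / (8 * (30 * Gb * KE * τ + 1))) := by
          ring
      _ ≤ η / 8 := this
  have p3 : 30 * (A * κg) * (KE * τ) ≤ η / 8 := by
    rw [hκg]
    have := mul_div_mul_add_one_le (x := 30 * A * KE * τ) (by positivity) hη.le (by norm_num : (0 : ℝ) < 8)
    calc 30 * (A * (η / (8 * (30 * A * KE * τ + 1)))) * (KE * τ) = 30 * A * KE * τ * (η / (8 * (30 * A * KE * τ + 1))) := by
          ring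
      _ ≤ η / 8 := this
  have p4 : cT * κT ≤ η / 8 := by
    rw [hκT]
    exact mul_div_mul_add_one_le hcT0 hη.le (by norm_num : (0 : ℝ) < 8)
  have p5 : Lr * r ≤ η / 4 := by
    have h1 : Lr * r ≤ Lr * (η / (4 * (Lr + 1))) := mul_le_mul_of_nonneg_left hrL hLr0
    exact h1.trans (mul_div_mul_add_one_le hLr0 hη.le (by norm_num : (0 : ℝ) < 4))
  have hr2 : r ^ 2 ≤ r := by nlinarith
  have h4r : 4 * r ^ 2 * (30 * Gb * A * KE) ≤ 4 * r * (30 * Gb * A * KE) := by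
    have : 0 ≤ 30 * Gb * A * KE := by positivity
    nlinarith
  -- regroup
  have e : 4 * r * (30 * Gb * A * KE) + (A * (ηW + ηW) + Gb * (3 * A * (4 * V * (16 * KE * r * τ + 16 * r * Kb) +
      4 * V ^ 2 * (8 * r * (1 / 2 + KE) * τ) + 6 * κT + 4 * κT)) + 30 * (Gb * κa + A * κg) * (KE * τ) +
      Gb * A * σ ^ 3 * Rcap / lam * (60 * V ^ 2 * (8 * r * (1 / 2 + KE) * τ) + 30 * κT)) =
      Lr * r + A * (ηW + ηW) + cT * κT + 30 * (Gb * κa) * (KE * τ) + 30 * (A * κg) * (KE * τ) := by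
    simp only [hcT, hLr]; ring
  linarith [e, p1, p2, p3, p4, p5, h4r]

/-! ## §4 A seven-piece union bound -/

/-- **Union bound**: a null set and six bad events of probability `≤ δ'` each cover the target event. [folklore] -/
theorem measure_le_of_cover6 {Ω : Type*} [MeasurableSpace Ω] (P : Measure Ω) {Z S₁ S₂ S₃ S₄ S₅ S₆ D : Set Ω}
    (hZ : P Z = 0) {δ' : ℝ} (h₁ : P S₁ ≤ ENNReal.ofReal δ') (h₂ : P S₂ ≤ ENNReal.ofReal δ')
    (h₃ : P S₃ ≤ ENNReal.ofReal δ') (h₄ : P S₄ ≤ ENNReal.ofReal δ') (h₅ : P S₅ ≤ ENNReal.ofReal δ')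
    (h₆ : P S₆ ≤ ENNReal.ofReal δ')
    (hD : ∀ z, z ∉ Z → z ∉ S₁ → z ∉ S₂ → z ∉ S₃ → z ∉ S₄ → z ∉ S₅ → z ∉ S₆ → z ∉ D) (hδ' : 0 ≤ δ') :
    P D ≤ ENNReal.ofReal (6 * δ') := by
  have hsub : D ⊆ Z ∪ S₁ ∪ S₂ ∪ S₃ ∪ S₄ ∪ S₅ ∪ S₆ := by
    intro z hz
    by_contra hcon
    simp only [Set.mem_union, not_or] at hcon
    obtain ⟨⟨⟨⟨⟨⟨n0, n1⟩, n2⟩, n3⟩, n4⟩, n5⟩, n6⟩ := hcon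
    exact hD z n0 n1 n2 n3 n4 n5 n6 hz
  calc P D ≤ P (Z ∪ S₁ ∪ S₂ ∪ S₃ ∪ S₄ ∪ S₅ ∪ S₆) := measure_mono hsub
    _ ≤ P Z + P S₁ + P S₂ + P S₃ + P S₄ + P S₅ + P S₆ := by
        refine (measure_union_le _ _).trans ?_
        gcongr
        refine (measure_union_le _ _).trans ?_
        gcongr
        refine (measure_union_le _ _).trans ?_
        gcongr
        refine (measure_union_le _ _).trans ?_
        gcongr
        refine (measure_union_le _ _).trans ?_
        gcongr
        exact measure_union_le _ _
    _ ≤ 0 + ENNReal.ofReal δ' + ENNReal.ofReal δ' + ENNReal.ofReal δ' + ENNReal.ofReal δ' + ENNReal.ofReal δ' +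
        ENNReal.ofReal δ' := by
        gcongr
        exact hZ.le
    _ = ENNReal.ofReal (6 * δ') := by
        rw [zero_add, show (6 : ℝ) * δ' = δ' + δ' + δ' + δ' + δ' + δ' by ring, ENNReal.ofReal_add (by positivity) hδ',
          ENNReal.ofReal_add (by positivity) hδ', ENNReal.ofReal_add (by positivity) hδ',
          ENNReal.ofReal_add (by positivity) hδ', ENNReal.ofReal_add hδ' hδ']

/-! ## §5 Registered sub-goal -/

/-- **Registered sub-goal `stub_stressIsotropyOfWindowCovarianceM` (helper M of
`stub_stressIsotropyOfWindowCovariance`): the uniform modulus of a continuous density cut-off vanishing above `η₀`,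
on `[0, ∞)`.** [folklore] -/
theorem stub_stressIsotropyOfWindowCovarianceM : ∀ {g : ℝ → ℝ}, Continuous g → ∀ {η₀ : ℝ}, (∀ b, η₀ ≤ b → g b = 0) → ∀ {κ : ℝ}, 0 < κ → ∃ lam : ℝ, 0 < lam ∧ ∀ b b', 0 ≤ b → 0 ≤ b' → |b - b'| < lam → |g b - g b'| ≤ κ :=
  fun hgc _ hg0 _ hκ => exists_modulus_of_vanishing hgc hg0 hκ

end Summit.AtomisticToContinuum.HydrodynamicLimit.Theorems.ParityBandClosureWindowToCone

end
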